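import Summits.CriticalPhenomena.PercolationContinuityZ3.Theorems.PercNearOneGluingNoHeavyLowerTailThreePointProductFormFibreCutVertex
import Summits.CriticalPhenomena.PercolationContinuityZ3.Theorems.PercNearOneGluingNoHeavyLowerTailThreePointProductFormFibreFlatPreimage
import HarnessLib

/-!
# The product form in the fibre language: the inequality (S1J) `(#bad + w)² ≤ #P1·#J` across a cut vertex
# (Sahi programme, prover prim-sahi-p2 gen 56)

Support file (`--supports stmt-CriticalPhenomena-4575`, helper); companion of `…ThreePointProductFormFibreCutVertex` (gen 54: (P) when the apex
separates `s` from `c`) and of `…FibreTerminalNetworkS1J` / `…S1Jc` (gen 56: the system `𝒮 = {(P), (S1J), (S1J′)}` is closed under terminal networks).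
Standard axioms, no sorries, no named facts, no definitions.  Memo `run/shared/lean/prim/prim-sahi/FROM-prim-sahi-p2-gen56-REFINED-PRODUCT-FORM.md` §10.

SETTING of `…FibreCutVertex`: the apex `a ∉ S` separates `S ∋ s` from the rest `∌ c`.  Then pointwise (`w_iff_of_separates`)
`w-set = {a ↔ s in z and in ♭z} ∩ {a ↮ c in z, a ↔ c in ♭z}` and `J = {a ↔ s} ∩ {a ↔ c}`, so with the independence count
`(#bad + w)·U = (#E₁ + #A₁)·#E₂ = #{a ↔ s in ♭z}·#E₂ = #{a ↔ s}·#E₂` (♭ is a bijection, `card_filter_flat_eq`), and (S1J) reduces to the two-point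
fact `#E₂² ≤ #{a ↔ c}·#{a ↮ c}` (`virtual_sq_le_conn_mul_disc`):
* **`S1J_of_separates`** [this work] — `(#bad + w)² ≤ #P1 · #J` whenever `a` separates `s` from `c`;
* **`S1Jc_of_separates`** [this work] — the mirror `(#bad + w′)² ≤ #P2 · #J` (the same theorem across the complementary side).
Hence the whole system `𝒮` holds across a cut vertex at the apex (with `productForm_of_separates`).  [folklore] (product counting);
[cite: Gladkov2024, Conjecture 10.1 (p. 18), arXiv:2408.08457] for CONJECTURE (P) served.
-/

namespace Summit.CriticalPhenomena.PercolationContinuityZ3.Theorems.ProductFormFibre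

open Finset Literature.Probability.Percolation
open Summit.CriticalPhenomena.PercolationContinuityZ3.Theorems.ThreePointCPIClusterSwap (clusterFlip)

variable {V α : Type*}

section CutVertexS1J

variable [Fintype α] [DecidableEq α] [DecidableEq V]

open Classical in
/-- **(S1J) ACROSS A CUT VERTEX.**  On a finite multigraph `(V, α, ends)` in which every label lies inside `S ∪ {a}` or outside `S` (`a ∉ S`),
for `s ∈ S` and `c ∉ S`, `c ≠ a`:  `(#bad + #{z ∈ P1 : s ↔ c in ♭z})² ≤ #P1 · #J`. [this work] -/
theorem S1J_of_separates (ends : α → Sym2 V) (a s c : V) (S : Set V)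
    (hsep : ∀ l : α, (∀ v ∈ ends l, v ∈ S ∨ v = a) ∨ (∀ v ∈ ends l, v ∉ S ∨ v = a))
    (haS : a ∉ S) (hs : s ∈ S) (hcS : c ∉ S) (hca : c ≠ a) :
    ((univ.filter fun z : α → Bool =>
        (¬ (openGraph (labelledOpen ends z)).Reachable a s ∧ ¬ (openGraph (labelledOpen ends z)).Reachable a c ∧
            ¬ (openGraph (labelledOpen ends z)).Reachable s c) ∧
          (openGraph (labelledOpen ends (clusterFlip ends a fun l => !z l))).Reachable s c).card +
      (univ.filter fun z : α → Bool =>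
        ((openGraph (labelledOpen ends z)).Reachable a s ∧ ¬ (openGraph (labelledOpen ends z)).Reachable a c) ∧
          (openGraph (labelledOpen ends (clusterFlip ends a fun l => !z l))).Reachable s c).card) ^ 2 ≤
    (univ.filter fun z : α → Bool =>
        (openGraph (labelledOpen ends z)).Reachable a s ∧ ¬ (openGraph (labelledOpen ends z)).Reachable a c).card *
    (univ.filter fun z : α → Bool =>
        (openGraph (labelledOpen ends z)).Reachable a s ∧ (openGraph (labelledOpen ends z)).Reachable a c).card := by
  set T : Set V := {v : V | v ∉ S ∧ v ≠ a} with hT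
  have hsepT := separates_compl ends a S hsep
  have haT : a ∉ T := fun h => h.2 rfl
  have hcT : c ∈ T := ⟨hcS, hca⟩
  let ins : α → Prop := fun l => (∀ v ∈ ends l, v ∈ S ∨ v = a) ∧ ¬ (ends l).IsDiag
  have hagS : ∀ z z' : α → Bool, (∀ l, ins l → z l = z' l) →
      ∀ l, (∀ v ∈ ends l, v ∈ S ∨ v = a) → ¬ (ends l).IsDiag → z l = z' l :=
    fun z z' h l hl hd => h l ⟨hl, hd⟩
  have hagT : ∀ z z' : α → Bool, (∀ l, ¬ ins l → z l = z' l) →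
      ∀ l, (∀ v ∈ ends l, v ∈ T ∨ v = a) → ¬ (ends l).IsDiag → z l = z' l := by
    intro z z' h l hl hd
    refine h l fun hins => hd (isDiag_of_forall_eq (a := a) fun v hv => ?_)
    rcases hins.1 v hv with h1 | h1
    · rcases hl v hv with h2 | h2
      · exact absurd h1 h2.1
      · exact h2
    · exact h1
  -- pointwise decompositions
  have hbad_eq : (univ.filter fun z : α → Bool =>
        (¬ (openGraph (labelledOpen ends z)).Reachable a s ∧ ¬ (openGraph (labelledOpen ends z)).Reachable a c ∧
          ¬ (openGraph (labelledOpen ends z)).Reachable s c) ∧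
        (openGraph (labelledOpen ends (clusterFlip ends a fun l => !z l))).Reachable s c) =
      (univ.filter fun z : α → Bool =>
        (¬ (openGraph (labelledOpen ends z)).Reachable a s ∧
          (openGraph (labelledOpen ends (clusterFlip ends a fun l => !z l))).Reachable a s) ∧
        (¬ (openGraph (labelledOpen ends z)).Reachable a c ∧
          (openGraph (labelledOpen ends (clusterFlip ends a fun l => !z l))).Reachable a c)) := by
    refine Finset.filter_congr fun z _ => ?_
    constructor
    · rintro ⟨⟨h1, h2, h3⟩, h4⟩
      have hsplit := reachable_apex_of_reachable ends a S hsep haS (clusterFlip ends a fun l => !z l) hs hcS h4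
      exact ⟨⟨h1, hsplit.1.symm⟩, ⟨h2, hsplit.2⟩⟩
    · rintro ⟨⟨h1, h1'⟩, ⟨h2, h2'⟩⟩
      refine ⟨⟨h1, h2, fun h3 => h1 ?_⟩, h1'.symm.trans h2'⟩
      exact (reachable_apex_of_reachable ends a S hsep haS z hs hcS h3).1.symm
  have hw_eq : (univ.filter fun z : α → Bool =>
        ((openGraph (labelledOpen ends z)).Reachable a s ∧ ¬ (openGraph (labelledOpen ends z)).Reachable a c) ∧
        (openGraph (labelledOpen ends (clusterFlip ends a fun l => !z l))).Reachable s c) =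
      (univ.filter fun z : α → Bool =>
        ((openGraph (labelledOpen ends z)).Reachable a s ∧
          (openGraph (labelledOpen ends (clusterFlip ends a fun l => !z l))).Reachable a s) ∧
        (¬ (openGraph (labelledOpen ends z)).Reachable a c ∧
          (openGraph (labelledOpen ends (clusterFlip ends a fun l => !z l))).Reachable a c)) := by
    refine Finset.filter_congr fun z _ => ?_
    constructor
    · rintro ⟨⟨h1, h2⟩, h4⟩
      have hsplit := reachable_apex_of_reachable ends a S hsep haS (clusterFlip ends a fun l => !z l) hs hcS h4
      exact ⟨⟨h1, hsplit.1.symm⟩, ⟨h2, hsplit.2⟩⟩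
    · rintro ⟨⟨h1, h1'⟩, ⟨h2, h2'⟩⟩
      exact ⟨⟨h1, h2⟩, h1'.symm.trans h2'⟩
  -- independence counts
  have hIbad := card_and_mul_card_univ ins
    (fun z => ¬ (openGraph (labelledOpen ends z)).Reachable a s ∧
      (openGraph (labelledOpen ends (clusterFlip ends a fun l => !z l))).Reachable a s)
    (fun z => ¬ (openGraph (labelledOpen ends z)).Reachable a c ∧
      (openGraph (labelledOpen ends (clusterFlip ends a fun l => !z l))).Reachable a c)
    (fun z z' h hz => (virtual_iff_of_agree ends a S hsep haS (hagS z z' h) (Or.inl hs)).1 hz)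
    (fun z z' h hz => (virtual_iff_of_agree ends a T hsepT haT (hagT z z' h) (Or.inl hcT)).1 hz)
  have hIw := card_and_mul_card_univ ins
    (fun z => (openGraph (labelledOpen ends z)).Reachable a s ∧
      (openGraph (labelledOpen ends (clusterFlip ends a fun l => !z l))).Reachable a s)
    (fun z => ¬ (openGraph (labelledOpen ends z)).Reachable a c ∧
      (openGraph (labelledOpen ends (clusterFlip ends a fun l => !z l))).Reachable a c)
    (by
      intro z z' h hz
      refine ⟨(reachable_iff_of_agree_inside ends a S hsep haS (hagS z z' h) (Or.inl hs)).1 hz.1, ?_⟩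
      exact (reachable_iff_of_agree_inside ends a S hsep haS
        (z := clusterFlip ends a fun x => !z x) (z' := clusterFlip ends a fun x => !z' x)
        (fun l hl hd => flat_apply_eq_of_agree ends a S hsep haS (hagS z z' h) hl hd) (Or.inl hs)).1 hz.2)
    (fun z z' h hz => (virtual_iff_of_agree ends a T hsepT haT (hagT z z' h) (Or.inl hcT)).1 hz)
  have hIP1 := card_and_mul_card_univ ins
    (fun z => (openGraph (labelledOpen ends z)).Reachable a s)
    (fun z => ¬ (openGraph (labelledOpen ends z)).Reachable a c)
    (fun z z' h hz => (reachable_iff_of_agree_inside ends a S hsep haS (hagS z z' h) (Or.inl hs)).1 hz)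
    (fun z z' h hz => fun h' => hz ((reachable_iff_of_agree_inside ends a T hsepT haT (hagT z z' h) (Or.inl hcT)).2 h'))
  have hIJ := card_and_mul_card_univ ins
    (fun z => (openGraph (labelledOpen ends z)).Reachable a s)
    (fun z => (openGraph (labelledOpen ends z)).Reachable a c)
    (fun z z' h hz => (reachable_iff_of_agree_inside ends a S hsep haS (hagS z z' h) (Or.inl hs)).1 hz)
    (fun z z' h hz => (reachable_iff_of_agree_inside ends a T hsepT haT (hagT z z' h) (Or.inl hcT)).1 hz)
  beta_reduce at hIbad hIw hIP1 hIJ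
  -- `#E₁ + #A₁ = #{a ↔ s in ♭z} = #{a ↔ s}`
  have hsplit := Finset.card_filter_add_card_filter_not
    (s := univ.filter fun z : α → Bool => (openGraph (labelledOpen ends (clusterFlip ends a fun l => !z l))).Reachable a s)
    (fun z : α → Bool => (openGraph (labelledOpen ends z)).Reachable a s)
  have eA : ((univ.filter fun z : α → Bool =>
        (openGraph (labelledOpen ends (clusterFlip ends a fun l => !z l))).Reachable a s).filter
        fun z : α → Bool => (openGraph (labelledOpen ends z)).Reachable a s) =
      (univ.filter fun z : α → Bool => (openGraph (labelledOpen ends z)).Reachable a s ∧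
        (openGraph (labelledOpen ends (clusterFlip ends a fun l => !z l))).Reachable a s) := by
    ext z; simp only [Finset.mem_filter, Finset.mem_univ, true_and]; tauto
  have eE : ((univ.filter fun z : α → Bool =>
        (openGraph (labelledOpen ends (clusterFlip ends a fun l => !z l))).Reachable a s).filter
        fun z : α → Bool => ¬ (openGraph (labelledOpen ends z)).Reachable a s) =
      (univ.filter fun z : α → Bool => ¬ (openGraph (labelledOpen ends z)).Reachable a s ∧
        (openGraph (labelledOpen ends (clusterFlip ends a fun l => !z l))).Reachable a s) := by
    ext z; simp only [Finset.mem_filter, Finset.mem_univ, true_and]; tauto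
  rw [eA, eE, card_filter_flat_eq ends a (fun w : α → Bool => (openGraph (labelledOpen ends w)).Reachable a s)] at hsplit
  have e2 := virtual_sq_le_conn_mul_disc ends a c
  rw [hbad_eq, hw_eq]
  set U := (univ : Finset (α → Bool)).card with hU
  set E1 := (univ.filter fun z : α → Bool => ¬ (openGraph (labelledOpen ends z)).Reachable a s ∧
        (openGraph (labelledOpen ends (clusterFlip ends a fun l => !z l))).Reachable a s).card with hE1
  set A1 := (univ.filter fun z : α → Bool => (openGraph (labelledOpen ends z)).Reachable a s ∧
        (openGraph (labelledOpen ends (clusterFlip ends a fun l => !z l))).Reachable a s).card with hA1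
  set E2 := (univ.filter fun z : α → Bool => ¬ (openGraph (labelledOpen ends z)).Reachable a c ∧
        (openGraph (labelledOpen ends (clusterFlip ends a fun l => !z l))).Reachable a c).card with hE2
  set F1 := (univ.filter fun z : α → Bool => (openGraph (labelledOpen ends z)).Reachable a s).card with hF1
  set F2 := (univ.filter fun z : α → Bool => (openGraph (labelledOpen ends z)).Reachable a c).card with hF2
  set G2 := (univ.filter fun z : α → Bool => ¬ (openGraph (labelledOpen ends z)).Reachable a c).card with hG2
  set Bd := (univ.filter fun z : α → Bool =>
        (¬ (openGraph (labelledOpen ends z)).Reachable a s ∧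
          (openGraph (labelledOpen ends (clusterFlip ends a fun l => !z l))).Reachable a s) ∧
        (¬ (openGraph (labelledOpen ends z)).Reachable a c ∧
          (openGraph (labelledOpen ends (clusterFlip ends a fun l => !z l))).Reachable a c)).card with hBd
  set Wd := (univ.filter fun z : α → Bool =>
        ((openGraph (labelledOpen ends z)).Reachable a s ∧
          (openGraph (labelledOpen ends (clusterFlip ends a fun l => !z l))).Reachable a s) ∧
        (¬ (openGraph (labelledOpen ends z)).Reachable a c ∧
          (openGraph (labelledOpen ends (clusterFlip ends a fun l => !z l))).Reachable a c)).card with hWd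
  set Q1 := (univ.filter fun z : α → Bool =>
        (openGraph (labelledOpen ends z)).Reachable a s ∧ ¬ (openGraph (labelledOpen ends z)).Reachable a c).card with hQ1
  set Jn := (univ.filter fun z : α → Bool =>
        (openGraph (labelledOpen ends z)).Reachable a s ∧ (openGraph (labelledOpen ends z)).Reachable a c).card with hJn
  have hUpos : 0 < U := Finset.card_pos.mpr Finset.univ_nonempty
  have hEA : A1 + E1 = F1 := hsplit
  have key : ((Bd + Wd) * U) ^ 2 ≤ (Q1 * U) * (Jn * U) := by
    have : (Bd + Wd) * U = F1 * E2 := by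
      rw [add_mul, hIbad, hIw, ← hEA]; ring
    rw [this, hIP1, hIJ]
    calc (F1 * E2) ^ 2 = F1 * F1 * E2 ^ 2 := by ring
      _ ≤ F1 * F1 * (F2 * G2) := Nat.mul_le_mul_left _ e2
      _ = F1 * G2 * (F1 * F2) := by ring
  have key' : (Bd + Wd) ^ 2 * (U * U) ≤ Q1 * Jn * (U * U) := by
    calc (Bd + Wd) ^ 2 * (U * U) = ((Bd + Wd) * U) ^ 2 := by ring
      _ ≤ (Q1 * U) * (Jn * U) := key
      _ = Q1 * Jn * (U * U) := by ring
  exact Nat.le_of_mul_le_mul_right key' (Nat.mul_pos hUpos hUpos)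

open Classical in
/-- **(S1J′) across a cut vertex** — the mirror `(#bad + #{z ∈ P2 : s ↔ c in ♭z})² ≤ #P2 · #J`, by the same theorem on the complementary side. [this work] -/
theorem S1Jc_of_separates (ends : α → Sym2 V) (a s c : V) (S : Set V)
    (hsep : ∀ l : α, (∀ v ∈ ends l, v ∈ S ∨ v = a) ∨ (∀ v ∈ ends l, v ∉ S ∨ v = a))
    (hs : s ∈ S) (hsa : s ≠ a) (hcS : c ∉ S) (hca : c ≠ a) :
    ((univ.filter fun z : α → Bool =>
        (¬ (openGraph (labelledOpen ends z)).Reachable a s ∧ ¬ (openGraph (labelledOpen ends z)).Reachable a c ∧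
            ¬ (openGraph (labelledOpen ends z)).Reachable s c) ∧
          (openGraph (labelledOpen ends (clusterFlip ends a fun l => !z l))).Reachable s c).card +
      (univ.filter fun z : α → Bool =>
        ((openGraph (labelledOpen ends z)).Reachable a c ∧ ¬ (openGraph (labelledOpen ends z)).Reachable a s) ∧
          (openGraph (labelledOpen ends (clusterFlip ends a fun l => !z l))).Reachable s c).card) ^ 2 ≤
    (univ.filter fun z : α → Bool =>
        (openGraph (labelledOpen ends z)).Reachable a c ∧ ¬ (openGraph (labelledOpen ends z)).Reachable a s).card *
    (univ.filter fun z : α → Bool =>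
        (openGraph (labelledOpen ends z)).Reachable a s ∧ (openGraph (labelledOpen ends z)).Reachable a c).card := by
  set T : Set V := {v : V | v ∉ S ∧ v ≠ a} with hT
  have hsepT := separates_compl ends a S hsep
  have haT : a ∉ T := fun h => h.2 rfl
  have hcT : c ∈ T := ⟨hcS, hca⟩
  have hsT : s ∉ T := fun h => h.1 hs
  have h := S1J_of_separates ends a c s T hsepT haT hcT hsT hsa
  have e1 : (univ.filter fun z : α → Bool =>
        (¬ (openGraph (labelledOpen ends z)).Reachable a c ∧ ¬ (openGraph (labelledOpen ends z)).Reachable a s ∧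
            ¬ (openGraph (labelledOpen ends z)).Reachable c s) ∧
          (openGraph (labelledOpen ends (clusterFlip ends a fun l => !z l))).Reachable c s) =
      (univ.filter fun z : α → Bool =>
        (¬ (openGraph (labelledOpen ends z)).Reachable a s ∧ ¬ (openGraph (labelledOpen ends z)).Reachable a c ∧
            ¬ (openGraph (labelledOpen ends z)).Reachable s c) ∧
          (openGraph (labelledOpen ends (clusterFlip ends a fun l => !z l))).Reachable s c) := by
    refine Finset.filter_congr fun z _ => ?_
    constructor
    · rintro ⟨⟨h1, h2, h3⟩, h4⟩; exact ⟨⟨h2, h1, fun h' => h3 h'.symm⟩, h4.symm⟩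
    · rintro ⟨⟨h1, h2, h3⟩, h4⟩; exact ⟨⟨h2, h1, fun h' => h3 h'.symm⟩, h4.symm⟩
  have e2 : (univ.filter fun z : α → Bool =>
        ((openGraph (labelledOpen ends z)).Reachable a c ∧ ¬ (openGraph (labelledOpen ends z)).Reachable a s) ∧
          (openGraph (labelledOpen ends (clusterFlip ends a fun l => !z l))).Reachable c s) =
      (univ.filter fun z : α → Bool =>
        ((openGraph (labelledOpen ends z)).Reachable a c ∧ ¬ (openGraph (labelledOpen ends z)).Reachable a s) ∧
          (openGraph (labelledOpen ends (clusterFlip ends a fun l => !z l))).Reachable s c) :=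
    Finset.filter_congr fun z _ => by
      constructor
      · rintro ⟨h1, h4⟩; exact ⟨h1, h4.symm⟩
      · rintro ⟨h1, h4⟩; exact ⟨h1, h4.symm⟩
  have e3 : (univ.filter fun z : α → Bool =>
        (openGraph (labelledOpen ends z)).Reachable a c ∧ (openGraph (labelledOpen ends z)).Reachable a s) =
      (univ.filter fun z : α → Bool =>
        (openGraph (labelledOpen ends z)).Reachable a s ∧ (openGraph (labelledOpen ends z)).Reachable a c) :=
    Finset.filter_congr fun z _ => and_comm
  rw [e1, e2, e3] at h
  exact h

end CutVertexS1J

end Summit.CriticalPhenomena.PercolationContinuityZ3.Theorems.ProductFormFibre
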